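/-
Copyright (c) 2026 the pub-hodgecm-mathlib formalisation cell (harness21).  Prover seat hodgecm-mathlib-LH4-p06 (g5), Track A «(D-RAM) FOUR-FRAME», unit U2H, census leaf
(ρ2b′-X) `stub_U2H_fixedPointCensus_typeTwo_unit0` — SOCKET (C) `orderCountCensusC` (type RamM), hand (C-2) «DEP∕TOP dischargers of ★ p857711's `hvTop`» (LH4-p04 (g5)
SOCKET (C) LEAD LINE #1, dealer LH4-plan (g12) WORD #30), FILE (L): THE TOP-CELL LAW IN THE CENSUS-SUM LETTERS `g, s0`.  2026-09-04.
-/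
import Summits.HodgeConjecture.HodgeConjecture.Theorems.F0P3cDyRamToricLevelCensusRamMTopCellsPrep   -- (L-prep, this seat): radii + ★ law repackaged; brings ★ Window∕Pack∕Side∕LAW-i∕TopPrep
import HarnessLib

/-!
# T5c (C-2, L): the TOP-CELL LAW of the RamM census in the letters of ★ `toricCensusSum_ramM` — `χ(c) ⟺ c + g + s0 ≤ jλ + 1 ∧ (c + 2 ≤ s0 + 2g ∨ side)`

Cell `hodgecm-mathlib` (D-0151), FLOOR 0, crux H413 = `stmt-HodgeConjecture-24833`; squad F0∕P3c∕LH4; lane `--supports stmt-HodgeConjecture-24833 --as helper` (count-neutral).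
THEOREMS ONLY (no `def`, no instance, no notation, no `sorry`, default heartbeats).  Socket served: LH4-p04 (g5)'s SOCKET (C) `orderCountCensusC` (type RamM bottom of
(ρ2b′-X)), brick (C-2) «DEP∕TOP»: the letter `hvTop` of ★ p857711 `toricCensusSum_ramM` says that on the coincidence diagonal `j + m = jλ + a` a non-generic cell is alive on
the `+` side iff `2j + (g + s0) ≤ 2jλ + 1 ∧ (j + a + 2 ≤ m + s0 + 2g ∨ ε = 1)` (and `ε = −1` on the `−` side).  In the radius letter `c := j + a − m` (`= 2j − jλ` on the
diagonal; cell radius `exp(−(2c + d_ρ))`) THIS FILE proves exactly that law for the two classes of ★ p857841: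
`TP(c) :⟺ ∃ ω ∈ U_M, |κ·t(ω) − 1| ≤ exp(−(2c + d_ρ))`, `TE(c) :⟺ ∃ ω ∈ U_M, |κ·ψ(n₀)·t(ω) − 1| ≤ exp(−(2c + d_ρ))` (`κ = ρμ∕μ`, `μ = λ − u`, `t(ω) = ρN(ω)∕N(ω)`, `ψ(n₀) = ρn₀∕n₀`):
* **`twistNear_iff_censusBit`** ∕ **`anchoredNear_iff_censusBit`**: with the dictionary `dΘ = 2g`, `dτ = 2s0`, `2d′ = d_ρ + dτ`, `2d_K = d_ρ + 2g`, the REGIME token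
  `m + s0 ≤ jλ ∨ m + 1 ≤ g + s0`, `2s0 + g ≤ jλ + 2`, and SIDE letters read at the ONE reference far cell `c″ = s0 + 2g − 1` (`TP(c″) → SideT`, `TE(c″) → SideE`,
  `¬(SideT ∧ SideE)` — the (C-5) sign dictionary asked at a single cell): `TP(c) ⟺ c + g + s0 ≤ jλ + 1 ∧ (c + 2 ≤ s0 + 2g ∨ SideT)`, `TE(c) ⟺ … ∨ SideE`.
WHY THE REGIME TOKEN: for `jλ < m + s0 ∧ g + s0 ≤ m` every top cell with `c > ℓ` is dead on both sides (L-prep §1) while the letter revives the far cells of side `ε`; under the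
census-sum parities (`jλ ≡ g`, `m ≡ g + s0`) that regime is expected to be empty (a (C-5) token) — it is not assumed silently here.
HONEST LABEL.  Count-neutral (`--supports`); unconditional local algebra; nothing of (ρ2b′-X) is asserted — `HC_CM` is proved only modulo the 7 printed citations (2 remaining named
inputs: hLiu418 = `stmt-HodgeConjecture-24832`, h413 = `stmt-HodgeConjecture-24833`) until rung 0 closes.

## References
* [Serre1979] J.-P. Serre, *Local Fields*, GTM 67 (1979): Ch. IV §1 Prop. 3–4 (the different of a ramified quadratic extension); Ch. V §1; Ch. V §3 Prop. 5, Cor. 3.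
* [Kottwitz1986BaseChangeUnits] R. E. Kottwitz, *Base change for unit elements of Hecke algebras*, Compositio Math. 60 (1986): §1 pp. 240–241.
* [Jacobowitz1962] R. Jacobowitz, *Hermitian forms over local fields*, Amer. J. Math. 84 (1962): §4.
-/

set_option autoImplicit false

noncomputable section

namespace Summit.HodgeConjecture.HodgeConjecture.Cruxes.H413.F0P3cDyRamToricLevelCensusRamM

open WithZero IsLocalRing
open scoped Valued
open Literature.NumberTheory.Automorphic.UnitaryThreeFourFrame (IsRamifiedQuadraticDatum)
open Literature.NumberTheory.LocalFields.QuadraticOrder Literature.NumberTheory.LocalFields.WildQuadraticDatum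

variable {K : Type} [Field K] [Valued K ℤᵐ⁰] {ρ Θ τ : K →+* K} {α ϖE : K} {dρ t dτ tτ : ℕ}
variable {K' : Type*} [Field K'] [Valued K' ℤᵐ⁰] {σ' : K' →+* K'} {π' : K'} {d' : ℕ}

/-! ## §3 The top-cell law in the census-sum letters `g, s0` -/

/-- **THE TOP-CELL LAW, CLASS T (the `+` table's `hvTop` bit of ★ `toricCensusSum_ramM`).**  Frame of ★ Pack (ρ-datum, `τ = Θρ` with its datum, fourth-field letters `P, d_K`,
third-field package, `Θ`-datum, `hFN`, a `Θ`-fixed unit non-norm `n₀`; `M` complete with finite residue field); tokens `|λ − u| = |ϖE|^m`, `|μ − ρμ| = |ϖE^{jλ}(α − ρα)|`;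
the DICTIONARY `dΘ = 2g`, `dτ = 2s0`, `2d′ = d_ρ + dτ`, `2d_K = d_ρ + 2g`; the REGIME token `m + s0 ≤ jλ ∨ m + 1 ≤ g + s0` and `2s0 + g ≤ jλ + 2`; SIDE letters read at the
reference far cell `c″ = s0 + 2g − 1` (`TP(c″) → SideT`, `TE(c″) → SideE`, `¬(SideT ∧ SideE)`).  Then for every radius letter `c`:
**`(∃ ω ∈ U_M, |κ·t(ω) − 1| ≤ exp(−(2c + d_ρ))) ⟺ c + g + s0 ≤ jλ + 1 ∧ (c + 2 ≤ s0 + 2g ∨ SideT)`.**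
[cite: Serre1979, Ch. V §3 Prop. 5, Cor. 3] [cite: Kottwitz1986BaseChangeUnits, §1 pp. 240–241] [cite: Jacobowitz1962, §4] -/
theorem twistNear_iff_censusBit [CompleteSpace K] [Finite 𝓀[K]]
    (hD : IsRamifiedQuadraticDatum ρ α dρ t) (hΘρ : ∀ x, Θ (ρ x) = ρ (Θ x)) (hvΘ : ∀ x, Valued.v (Θ x) = Valued.v x)
    (hτ : ∀ x, τ x = Θ (ρ x)) (hDτ : IsRamifiedQuadraticDatum τ α dτ tτ)
    {P : K} (hτP : τ P = P) (hP : Valued.v P = exp (-2 : ℤ)) {dK : ℕ} (hdK : Valued.v (P - ρ P) = exp (-(2 * (dK : ℤ))))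
    (hσ' : ∀ x, σ' (σ' x) = x) (hvσ' : ∀ x, Valued.v (σ' x) = Valued.v x) (hfix' : ∀ x : K', σ' x = x → x ≠ 0 → ∃ n : ℤ, Valued.v x = exp (2 * n))
    (hπ' : Valued.v π' = exp (-1 : ℤ)) (hdd' : Valued.v (π' - σ' π') = Valued.v π' ^ d')
    (jK : K' →+* K) (hjle : ∀ x y : K', Valued.v (jK x) ≤ Valued.v (jK y) ↔ Valued.v x ≤ Valued.v y) (hjΘ : ∀ x, Θ (jK x) = jK x)
    (hjfix : ∀ z : K, Θ z = z → ∃ x, jK x = z) (hjσ : ∀ x, jK (σ' x) = ρ (jK x)) (hjπ : Valued.v (jK π') = exp (-2 : ℤ))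
    {ϖ : K} {dΘ tΘ : ℕ} (hDΘ : IsRamifiedQuadraticDatum Θ ϖ dΘ tΘ)
    (hFN : ∀ f : K, ρ f = f → Θ f = f → Valued.v f = 1 → ∃ x : K, x * Θ x = f)
    {n₀ : K} (hΘn₀ : Θ n₀ = n₀) (hn₀1 : Valued.v n₀ = 1) (hn₀N : ¬ ∃ z : K, z * Θ z = n₀)
    (hϖE : Valued.v ϖE = exp (-2 : ℤ)) {lam u : K} (hlam : lam * Θ lam = 1) (hu : ρ u = u) (hu1 : u * Θ u = 1)
    {m jl : ℕ} (hμ : Valued.v (lam - u) = Valued.v ϖE ^ m) (hjl : Valued.v ((lam - u) - ρ (lam - u)) = Valued.v (ϖE ^ jl * (α - ρ α)))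
    {g s0 : ℕ} (hg : dΘ = 2 * g) (hs0 : dτ = 2 * s0) (hd' : 2 * d' = dρ + dτ) (hdK2 : 2 * dK = dρ + 2 * g)
    (hAB : m + s0 ≤ jl ∨ m + 1 ≤ g + s0) (hjlS : 2 * s0 + g ≤ jl + 2) (SideT SideE : Prop)
    (hST : (∃ ω : K, Valued.v ω = 1 ∧ Valued.v (ρ (lam - u) / (lam - u) * (ρ (ω * Θ ω) / (ω * Θ ω)) - 1) ≤ exp (-(2 * ((s0 : ℤ) + 2 * g - 1) + dρ))) → SideT)
    (hSE : (∃ ω : K, Valued.v ω = 1 ∧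
      Valued.v (ρ (lam - u) / (lam - u) * (ρ n₀ / n₀) * (ρ (ω * Θ ω) / (ω * Θ ω)) - 1) ≤ exp (-(2 * ((s0 : ℤ) + 2 * g - 1) + dρ))) → SideE)
    (hTE : ¬ (SideT ∧ SideE)) (c : ℕ) :
    (∃ ω : K, Valued.v ω = 1 ∧ Valued.v (ρ (lam - u) / (lam - u) * (ρ (ω * Θ ω) / (ω * Θ ω)) - 1) ≤ exp (-(2 * (c : ℤ) + dρ))) ↔
      c + g + s0 ≤ jl + 1 ∧ (c + 2 ≤ s0 + 2 * g ∨ SideT) := by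
  obtain ⟨hρρ, hvρ, -, -, -, -, -⟩ := id hD
  have hΘΘ := hDΘ.1
  have hg1 : 1 ≤ g := by have h1 := hDΘ.2.2.2.2.2.1; omega
  have hμ0 : lam - u ≠ 0 := fun h0 => by
    rw [h0, map_zero, v_varpiE_pow hϖE] at hμ; exact exp_ne_zero hμ.symm
  have hκ1 : Valued.v (ρ (lam - u) / (lam - u)) = 1 := (token_twist_mu hρρ hvρ hμ0).2
  have hκv : Valued.v (ρ (lam - u) / (lam - u) - 1) = exp (2 * (m : ℤ) - 2 * jl - dρ) := by
    rw [← neg_sub, Valuation.map_neg]; exact v_one_sub_twist_eq_ramified hD hϖE hμ hjl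
  -- `TP` at every radius down to `κ`'s own
  have hT_of_le : ∀ z : ℤ, z + m ≤ jl →
      ∃ ω : K, Valued.v ω = 1 ∧ Valued.v (ρ (lam - u) / (lam - u) * (ρ (ω * Θ ω) / (ω * Θ ω)) - 1) ≤ exp (-(2 * z + dρ)) := fun z hz =>
    twistNear_one _ (by rw [hκv, exp_le_exp]; omega)
  -- alive ⇒ depth, for `s0 ≤ c′`
  have hdep : ∀ c' : ℕ, s0 ≤ c' →
      ((∃ ω : K, Valued.v ω = 1 ∧ Valued.v (ρ (lam - u) / (lam - u) * (ρ (ω * Θ ω) / (ω * Θ ω)) - 1) ≤ exp (-(2 * (c' : ℤ) + dρ))) ∨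
        ∃ ω : K, Valued.v ω = 1 ∧ Valued.v (ρ (lam - u) / (lam - u) * (ρ n₀ / n₀) * (ρ (ω * Θ ω) / (ω * Θ ω)) - 1) ≤ exp (-(2 * (c' : ℤ) + dρ))) →
      c' + g + s0 ≤ jl + 1 := fun c' hc' h => by
    have h1 := censusDepth_of_twistNear_or_anchoredNear hD hΘΘ hΘρ hvΘ hτ hDτ hτP hP hdK hfix' hπ' jK hjle hjfix hjσ hjπ hΘn₀ hn₀1 hϖE hlam hu hu1 hjl
      (c := c') (by omega) h
    omega
  by_cases hA : m + s0 ≤ jl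
  · -- regime A: `κ ∈ 1 + 𝔭^{2d′}`
    -- depth ⇒ some class alive, for `s0 ≤ c′`
    have halive : ∀ c' : ℕ, s0 ≤ c' → c' + g + s0 ≤ jl + 1 →
        (∃ ω : K, Valued.v ω = 1 ∧ Valued.v (ρ (lam - u) / (lam - u) * (ρ (ω * Θ ω) / (ω * Θ ω)) - 1) ≤ exp (-(2 * (c' : ℤ) + dρ))) ∨
          ∃ ω : K, Valued.v ω = 1 ∧ Valued.v (ρ (lam - u) / (lam - u) * (ρ n₀ / n₀) * (ρ (ω * Θ ω) / (ω * Θ ω)) - 1) ≤ exp (-(2 * (c' : ℤ) + dρ)) :=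
      fun c' hc' hd => twistNear_or_anchoredNear_of_censusDepth hD hΘρ hvΘ hτ hDτ hτP hP hdK hσ' hvσ' hfix' hπ' hdd' jK hjle hjΘ hjfix hjσ hjπ hDΘ
        hΘn₀ hn₀1 hn₀N hϖE hlam hu hu1 hμ hjl (by omega) (by omega) (by omega) (by omega)
    by_cases hcl : (c : ℤ) + m ≤ jl
    · -- zone I: `κ` itself lies in the cell's ball
      have hT := hT_of_le c hcl
      refine ⟨fun _ => ⟨?_, ?_⟩, fun _ => hT⟩
      · by_cases hcs : s0 ≤ c
        · exact hdep c hcs (Or.inl hT)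
        · have h1 := hdep s0 le_rfl (Or.inl (hT_of_le s0 (by omega))); omega
      · by_cases hthr : c + 2 ≤ s0 + 2 * g
        · exact Or.inl hthr
        · exact Or.inr (hST (hT_of_le _ (by omega)))
    · -- zone II: beyond `κ`'s own radius (`c ≥ s0 + 1`)
      by_cases hthr : c + 2 ≤ s0 + 2 * g
      · rw [twistNear_iff_depth_of_lt_threshold hD hΘρ hvΘ hτ hDτ hτP hP hdK hσ' hvσ' hfix' hπ' hdd' jK hjle hjΘ hjfix hjσ hjπ hDΘ hFN hΘn₀ hn₀1 hn₀N
          hϖE hlam hu hu1 hμ hjl (c' := c) (k' := c - s0) (by omega) (by omega) (by omega) (by omega)]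
        constructor
        · intro hd; exact ⟨by omega, Or.inl hthr⟩
        · rintro ⟨hd, -⟩; omega
      · by_cases hadm : 2 * s0 + 3 * g ≤ jl + 2
        · have h := twistNear_iff_depth_and_ref_of_threshold_le hD hΘρ hvΘ hτ hDτ hτP hP hdK hσ' hvσ' hfix' hπ' hdd' jK hjle hjΘ hjfix hjσ hjπ hDΘ hFN
            hΘn₀ hn₀1 hn₀N hϖE hlam hu hu1 hμ hjl (by omega) (c' := c) (k' := c - s0) (by omega) (by omega) (by omega)
            (c'' := s0 + 2 * g - 1) (k'' := 2 * g - 1) (by omega) (by omega) (by omega) (by omega)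
          rw [show ((s0 + 2 * g - 1 : ℕ) : ℤ) = (s0 : ℤ) + 2 * g - 1 by omega] at h
          rw [h]
          constructor
          · rintro ⟨hd, hTref⟩; exact ⟨by omega, Or.inr (hST hTref)⟩
          · rintro ⟨hd, hside⟩
            rcases hside with hthr' | hS
            · exact absurd hthr' hthr
            refine ⟨by omega, ?_⟩
            rcases halive (s0 + 2 * g - 1) (by omega) (by omega) with hTref | hEref
            · rwa [show ((s0 + 2 * g - 1 : ℕ) : ℤ) = (s0 : ℤ) + 2 * g - 1 by omega] at hTref
            · rw [show ((s0 + 2 * g - 1 : ℕ) : ℤ) = (s0 : ℤ) + 2 * g - 1 by omega] at hEref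
              exact absurd ⟨hS, hSE hEref⟩ hTE
        · constructor
          · intro hT; have h1 := hdep c (by omega) (Or.inl hT); omega
          · rintro ⟨hd, -⟩; omega
  · -- regime B: `κ` shallow (`jλ < m + s0`), small `m`
    have hmB : m + 1 ≤ g + s0 := hAB.resolve_left hA
    by_cases hcl : (c : ℤ) + m ≤ jl
    · exact ⟨fun _ => ⟨by omega, Or.inl (by omega)⟩, fun _ => hT_of_le c hcl⟩
    · have hdead := (not_twistNear_not_anchoredNear_of_shallow hΘΘ hvΘ hvρ hσ' hfix' hπ' hdd' jK hjle hjfix hjσ hjπ hΘn₀ hn₀1 hκ1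
        (by rw [hκv, exp_lt_exp]; omega) (r := exp (-(2 * (c : ℤ) + dρ))) (by rw [hκv, exp_lt_exp]; omega)).1
      exact ⟨fun hT => absurd hT hdead, fun h => by omega⟩

/-- **THE TOP-CELL LAW, CLASS E (the `−` table's `hvTop` bit of ★ `toricCensusSum_ramM`).**  Same frame, dictionary, regime token and side letters:
**`(∃ ω ∈ U_M, |κ·ψ(n₀)·t(ω) − 1| ≤ exp(−(2c + d_ρ))) ⟺ c + g + s0 ≤ jλ + 1 ∧ (c + 2 ≤ s0 + 2g ∨ SideE)`.**
[cite: Serre1979, Ch. V §3 Prop. 5, Cor. 3] [cite: Kottwitz1986BaseChangeUnits, §1 pp. 240–241] [cite: Jacobowitz1962, §4] -/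
theorem anchoredNear_iff_censusBit [CompleteSpace K] [Finite 𝓀[K]]
    (hD : IsRamifiedQuadraticDatum ρ α dρ t) (hΘρ : ∀ x, Θ (ρ x) = ρ (Θ x)) (hvΘ : ∀ x, Valued.v (Θ x) = Valued.v x)
    (hτ : ∀ x, τ x = Θ (ρ x)) (hDτ : IsRamifiedQuadraticDatum τ α dτ tτ)
    {P : K} (hτP : τ P = P) (hP : Valued.v P = exp (-2 : ℤ)) {dK : ℕ} (hdK : Valued.v (P - ρ P) = exp (-(2 * (dK : ℤ))))
    (hσ' : ∀ x, σ' (σ' x) = x) (hvσ' : ∀ x, Valued.v (σ' x) = Valued.v x) (hfix' : ∀ x : K', σ' x = x → x ≠ 0 → ∃ n : ℤ, Valued.v x = exp (2 * n))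
    (hπ' : Valued.v π' = exp (-1 : ℤ)) (hdd' : Valued.v (π' - σ' π') = Valued.v π' ^ d')
    (jK : K' →+* K) (hjle : ∀ x y : K', Valued.v (jK x) ≤ Valued.v (jK y) ↔ Valued.v x ≤ Valued.v y) (hjΘ : ∀ x, Θ (jK x) = jK x)
    (hjfix : ∀ z : K, Θ z = z → ∃ x, jK x = z) (hjσ : ∀ x, jK (σ' x) = ρ (jK x)) (hjπ : Valued.v (jK π') = exp (-2 : ℤ))
    {ϖ : K} {dΘ tΘ : ℕ} (hDΘ : IsRamifiedQuadraticDatum Θ ϖ dΘ tΘ)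
    (hFN : ∀ f : K, ρ f = f → Θ f = f → Valued.v f = 1 → ∃ x : K, x * Θ x = f)
    {n₀ : K} (hΘn₀ : Θ n₀ = n₀) (hn₀1 : Valued.v n₀ = 1) (hn₀N : ¬ ∃ z : K, z * Θ z = n₀)
    (hϖE : Valued.v ϖE = exp (-2 : ℤ)) {lam u : K} (hlam : lam * Θ lam = 1) (hu : ρ u = u) (hu1 : u * Θ u = 1)
    {m jl : ℕ} (hμ : Valued.v (lam - u) = Valued.v ϖE ^ m) (hjl : Valued.v ((lam - u) - ρ (lam - u)) = Valued.v (ϖE ^ jl * (α - ρ α)))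
    {g s0 : ℕ} (hg : dΘ = 2 * g) (hs0 : dτ = 2 * s0) (hd' : 2 * d' = dρ + dτ) (hdK2 : 2 * dK = dρ + 2 * g)
    (hAB : m + s0 ≤ jl ∨ m + 1 ≤ g + s0) (hjlS : 2 * s0 + g ≤ jl + 2) (SideT SideE : Prop)
    (hST : (∃ ω : K, Valued.v ω = 1 ∧ Valued.v (ρ (lam - u) / (lam - u) * (ρ (ω * Θ ω) / (ω * Θ ω)) - 1) ≤ exp (-(2 * ((s0 : ℤ) + 2 * g - 1) + dρ))) → SideT)
    (hSE : (∃ ω : K, Valued.v ω = 1 ∧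
      Valued.v (ρ (lam - u) / (lam - u) * (ρ n₀ / n₀) * (ρ (ω * Θ ω) / (ω * Θ ω)) - 1) ≤ exp (-(2 * ((s0 : ℤ) + 2 * g - 1) + dρ))) → SideE)
    (hTE : ¬ (SideT ∧ SideE)) (c : ℕ) :
    (∃ ω : K, Valued.v ω = 1 ∧ Valued.v (ρ (lam - u) / (lam - u) * (ρ n₀ / n₀) * (ρ (ω * Θ ω) / (ω * Θ ω)) - 1) ≤ exp (-(2 * (c : ℤ) + dρ))) ↔
      c + g + s0 ≤ jl + 1 ∧ (c + 2 ≤ s0 + 2 * g ∨ SideE) := by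
  obtain ⟨hρρ, hvρ, -, -, -, -, -⟩ := id hD
  have hΘΘ := hDΘ.1
  have hg1 : 1 ≤ g := by have h1 := hDΘ.2.2.2.2.2.1; omega
  have hμ0 : lam - u ≠ 0 := fun h0 => by
    rw [h0, map_zero, v_varpiE_pow hϖE] at hμ; exact exp_ne_zero hμ.symm
  have hκ1 : Valued.v (ρ (lam - u) / (lam - u)) = 1 := (token_twist_mu hρρ hvρ hμ0).2
  have hκv : Valued.v (ρ (lam - u) / (lam - u) - 1) = exp (2 * (m : ℤ) - 2 * jl - dρ) := by
    rw [← neg_sub, Valuation.map_neg]; exact v_one_sub_twist_eq_ramified hD hϖE hμ hjl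
  have hT_of_le : ∀ z : ℤ, z + m ≤ jl →
      ∃ ω : K, Valued.v ω = 1 ∧ Valued.v (ρ (lam - u) / (lam - u) * (ρ (ω * Θ ω) / (ω * Θ ω)) - 1) ≤ exp (-(2 * z + dρ)) := fun z hz =>
    twistNear_one _ (by rw [hκv, exp_le_exp]; omega)
  -- `TE` at the radii down to `κ`'s own that stay above `2d′`
  have hE_of_le : ∀ z : ℤ, z + m ≤ jl → 2 * z + dρ ≤ 2 * d' →
      ∃ ω : K, Valued.v ω = 1 ∧ Valued.v (ρ (lam - u) / (lam - u) * (ρ n₀ / n₀) * (ρ (ω * Θ ω) / (ω * Θ ω)) - 1) ≤ exp (-(2 * z + dρ)) :=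
    fun z hz hzd => anchoredNear_of_le_of_le hσ' hfix' hπ' hdd' jK hjle hjfix hjσ hjπ hΘn₀ hn₀1 hκ1 (by rw [hκv, exp_le_exp]; omega)
      (by rw [exp_le_exp]; omega)
  have hdep : ∀ c' : ℕ, s0 ≤ c' →
      ((∃ ω : K, Valued.v ω = 1 ∧ Valued.v (ρ (lam - u) / (lam - u) * (ρ (ω * Θ ω) / (ω * Θ ω)) - 1) ≤ exp (-(2 * (c' : ℤ) + dρ))) ∨
        ∃ ω : K, Valued.v ω = 1 ∧ Valued.v (ρ (lam - u) / (lam - u) * (ρ n₀ / n₀) * (ρ (ω * Θ ω) / (ω * Θ ω)) - 1) ≤ exp (-(2 * (c' : ℤ) + dρ))) →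
      c' + g + s0 ≤ jl + 1 := fun c' hc' h => by
    have h1 := censusDepth_of_twistNear_or_anchoredNear hD hΘΘ hΘρ hvΘ hτ hDτ hτP hP hdK hfix' hπ' jK hjle hjfix hjσ hjπ hΘn₀ hn₀1 hϖE hlam hu hu1 hjl
      (c := c') (by omega) h
    omega
  by_cases hA : m + s0 ≤ jl
  · -- regime A
    have halive : ∀ c' : ℕ, s0 ≤ c' → c' + g + s0 ≤ jl + 1 →
        (∃ ω : K, Valued.v ω = 1 ∧ Valued.v (ρ (lam - u) / (lam - u) * (ρ (ω * Θ ω) / (ω * Θ ω)) - 1) ≤ exp (-(2 * (c' : ℤ) + dρ))) ∨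
          ∃ ω : K, Valued.v ω = 1 ∧ Valued.v (ρ (lam - u) / (lam - u) * (ρ n₀ / n₀) * (ρ (ω * Θ ω) / (ω * Θ ω)) - 1) ≤ exp (-(2 * (c' : ℤ) + dρ)) :=
      fun c' hc' hd => twistNear_or_anchoredNear_of_censusDepth hD hΘρ hvΘ hτ hDτ hτP hP hdK hσ' hvσ' hfix' hπ' hdd' jK hjle hjΘ hjfix hjσ hjπ hDΘ
        hΘn₀ hn₀1 hn₀N hϖE hlam hu hu1 hμ hjl (by omega) (by omega) (by omega) (by omega)
    by_cases hcl : (c : ℤ) + m ≤ jl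
    · -- zone I
      have hT := hT_of_le c hcl
      have hd : c + g + s0 ≤ jl + 1 := by
        by_cases hcs : s0 ≤ c
        · exact hdep c hcs (Or.inl hT)
        · have h1 := hdep s0 le_rfl (Or.inl (hT_of_le s0 (by omega))); omega
      by_cases hcs : c ≤ s0
      · exact ⟨fun _ => ⟨hd, Or.inl (by omega)⟩, fun _ => hE_of_le c hcl (by omega)⟩
      · -- inside `κ`'s ball below `2d′`: class E is the threshold
        have hR : Valued.v (jK π' ^ (d' + (c - s0))) = exp (-(2 * (c : ℤ) + dρ)) := by
          rw [v_map_pow_eq_exp_neg_two_mul jK hjπ]; congr 1; omega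
        have hthrE := anchoredNear_iff_lt_threshold_of_near_one hvΘ hσ' hvσ' hfix' hπ' hdd' jK hjle hjΘ hjfix hjσ hjπ hDΘ hFN hΘn₀ hn₀1 hn₀N (c - s0) hκ1
          (by rw [hR, hκv, exp_le_exp]; omega)
        rw [hR] at hthrE
        rw [hthrE]
        constructor
        · intro hk; exact ⟨hd, Or.inl (by omega)⟩
        · rintro ⟨-, hthr | hS⟩
          · omega
          · by_contra hk
            exact hTE ⟨hST (hT_of_le _ (by omega)), hS⟩
    · -- zone II
      by_cases hthr : c + 2 ≤ s0 + 2 * g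
      · rw [anchoredNear_iff_depth_of_lt_threshold hD hΘρ hvΘ hτ hDτ hτP hP hdK hσ' hvσ' hfix' hπ' hdd' jK hjle hjΘ hjfix hjσ hjπ hDΘ hFN hΘn₀ hn₀1 hn₀N
          hϖE hlam hu hu1 hμ hjl (c' := c) (k' := c - s0) (by omega) (by omega) (by omega) (by omega)]
        constructor
        · intro hd; exact ⟨by omega, Or.inl hthr⟩
        · rintro ⟨hd, -⟩; omega
      · by_cases hadm : 2 * s0 + 3 * g ≤ jl + 2
        · have h := anchoredNear_iff_depth_and_ref_of_threshold_le hD hΘρ hvΘ hτ hDτ hτP hP hdK hσ' hvσ' hfix' hπ' hdd' jK hjle hjΘ hjfix hjσ hjπ hDΘ hFN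
            hΘn₀ hn₀1 hn₀N hϖE hlam hu hu1 hμ hjl (by omega) (c' := c) (k' := c - s0) (by omega) (by omega) (by omega)
            (c'' := s0 + 2 * g - 1) (k'' := 2 * g - 1) (by omega) (by omega) (by omega) (by omega)
          rw [show ((s0 + 2 * g - 1 : ℕ) : ℤ) = (s0 : ℤ) + 2 * g - 1 by omega] at h
          rw [h]
          constructor
          · rintro ⟨hd, hEref⟩; exact ⟨by omega, Or.inr (hSE hEref)⟩
          · rintro ⟨hd, hside⟩
            rcases hside with hthr' | hS
            · exact absurd hthr' hthr
            refine ⟨by omega, ?_⟩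
            rcases halive (s0 + 2 * g - 1) (by omega) (by omega) with hTref | hEref
            · rw [show ((s0 + 2 * g - 1 : ℕ) : ℤ) = (s0 : ℤ) + 2 * g - 1 by omega] at hTref
              exact absurd ⟨hST hTref, hS⟩ hTE
            · rwa [show ((s0 + 2 * g - 1 : ℕ) : ℤ) = (s0 : ℤ) + 2 * g - 1 by omega] at hEref
        · constructor
          · intro hE; have h1 := hdep c (by omega) (Or.inr hE); omega
          · rintro ⟨hd, -⟩; omega
  · -- regime B
    have hmB : m + 1 ≤ g + s0 := hAB.resolve_left hA
    by_cases hcl : (c : ℤ) + m ≤ jl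
    · exact ⟨fun _ => ⟨by omega, Or.inl (by omega)⟩, fun _ => hE_of_le c hcl (by omega)⟩
    · have hdead := (not_twistNear_not_anchoredNear_of_shallow hΘΘ hvΘ hvρ hσ' hfix' hπ' hdd' jK hjle hjfix hjσ hjπ hΘn₀ hn₀1 hκ1
        (by rw [hκv, exp_lt_exp]; omega) (r := exp (-(2 * (c : ℤ) + dρ))) (by rw [hκv, exp_lt_exp]; omega)).2
      exact ⟨fun hE => absurd hE hdead, fun h => by omega⟩

end Summit.HodgeConjecture.HodgeConjecture.Cruxes.H413.F0P3cDyRamToricLevelCensusRamM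

end
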